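import Summits.Ventures.CertifiedManyBodySolver.Observables.StiffnessApexTransportFermiSeaAnchor
import Summits.Ventures.CertifiedManyBodySolver.Observables.StiffnessTLKineticCeilingURay
import HarnessLib

/-!
# Ventures/CertifiedManyBodySolver — Observables/StiffnessApexTransportRayStation.lean

HONEST FRAMING: one-sided certified CEILINGS on the uniform flux stiffness (t–t′ f-sum class) at ANY density, transported to a target with `t′ ≠ 0`
from a `t′ = 0` STATION whose certified word is a KINETIC ceiling `−k(ω) ≤ X` (bond-form kinetic density), used as ONE member of the weighted apex bracket;
every leaf is CONDITIONAL on the rows / claim nodes it names; a ceiling never speaks to the presence of order; not a `T_c` estimate, not a superconductivity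
verdict; no number of record. Zero compute, no definition, no claim node, no `sorry`.

Cell `pub/hubbard-fast` (D-0154 (1)(A) «CERTIFICATE REUSE along parameter paths»), seat `hubbard-fast-reuse-2` g4 (`prover-hubbard-fast-reuse-2-g4-0`), path family
«APEX TRANSPORT», line «FERMI-SEA ANCHOR», device «RAY STATION». Companion of this seat's `Observables/StiffnessApexTransportWeightedBracket.lean` (g3) and
`Observables/StiffnessApexTransportFermiSeaAnchor.lean` (g4, p656029).

THE POINT. The tree's `t′ = 0` stiffness words are KINETIC ceilings `−k(ω) ≤ X` on the torus-limit ground-state class of `(0, U₀, n)` (e.g. the (8, 7/8, 0) kinlo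
affine node read on [#529, #550], `obs0b_kin_EXT5Lp_affine_negKinetic_le_r529_r550_of`, `X = 1.3352430`, and its transport up the `U`-ray,
`Observables/StiffnessTLKineticCeilingURay`). By the dictionary `meanEnergy_hubbardTTPrime_oneBody_eq_kineticDensity` such a word IS a floor
`−X ≤ e_{Φ(1,0,0)}(ω)` on that class, and with a floor `B ≤ K₂(ω)` (e.g. the hypothesis-free kinematic `−1.6211390`) it becomes the hopping floor
`−X + κB ≤ e_{Φ(1,κ,0)}(ω)` for every `κ ≥ 0` (`meanEnergy_hopping_add_mul_le_of_le_diagHop`) — exactly the shape the weighted apex bracket consumes for a source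
at `(s₂, U₂) = (0, U₀)`. For a hole-doped target `(t′_P < 0, U_P > U₀)` the apex hopping of the line to `(0, U₀)` is `κ₂ = −U₀t′_P/(U_P − U₀) > 0 > 2t′_P`, so the
`t′ = 0` station is ALWAYS an admissible RIGHT member; near `t′_P → 0⁻` its weight `μ₂ → 1` and the bracket word tends to the ray word `X/4` continuously —
this words the doped cells with `t′ ∈ (−1/10, 0)` from the `t′ = 0` ray.

* §1 `hoppingFloor_of_negKinetic_le_of_le_diagHop` — the adapter (kinetic ceiling + `K₂` floor ⇒ hopping floor at `κ ≥ 0`);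
* §2 corollaries of the two masters: «own-word-and-floor × ray station» / «own-word-and-ceiling × ray station» / «slot × ray station»
  (`ObsStiffnessSeqCeilingAt_of_two_apexSources_weighted_of_{fsumFloor,fsumCeil,slot}_negKinetic`, g3's master) and «Fermi-sea row × ray station»
  (`ObsStiffnessSeqCeilingAt_of_rayStation_fermiSeaRow_weighted`, g4's master with the station as source 1).

NOT said: nothing flows toward `U_P ≤ U₀`; the `K₂` floor on a `t′ = 0` doped class is only the kinematic one in the tree today (price `κ₂·0.4052848`), so the
device pays off only where `κ₂ = U₀|t′_P|/(U_P − U₀)` is small (`U_P` well above `U₀`, `|t′_P|` small); `λ ≠ 0` words are not of this form; no `T > 0`.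

References: T. Koma, H. Tasaki, J. Stat. Phys. 76 (1994) 745, §1 [KomaTasaki1994]; D. J. Scalapino, S. R. White, S.-C. Zhang, PRB 47 (1993) 7995, §II
[ScalapinoWhiteZhang1993]; O. Bratteli, D. W. Robinson, Operator Algebras and Quantum Statistical Mechanics II (1997), §6.2.4 [BratteliRobinsonII1997];
E. H. Lieb, M. Loss, Duke Math. J. 71 (1993) 337, §8 Theorem 8.2 [LiebLoss1993].
-/

noncomputable section

namespace Summit.Ventures.CertifiedManyBodySolver.Observables

open Literature.MathematicalPhysics.QuantumLattice
open Literature.MathematicalPhysics.QuantumLattice.ThermodynamicLimit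
open Literature.MathematicalPhysics.QuantumFieldTheory
open Literature.Probability.LatticeModels
open Matrix Finset Filter Topology HubbardWave0
open scoped Matrix BigOperators ComplexOrder

/-! ## §1 The adapter: a kinetic ceiling on a `t′ = 0` class is a hopping floor at every `κ ≥ 0` -/

section Adapter

variable {U₀ n : ℝ}

/-- **Kinetic ceiling + `K₂` floor ⇒ hopping floor (`t′ = 0` station).** If `−k(ω) ≤ X` (bond-form kinetic density) and `B ≤ K₂(ω)` for every torus limit `ω` of
unit `(rectN n L, S^z = 0)`-sector ground states of `hubbardTorusTT' L 1 0 U₀`, then `−X + κB ≤ e_{Φ(1,κ,0)}(ω)` on that class for every `κ ≥ 0`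
(`meanEnergy_hubbardTTPrime_oneBody_eq_kineticDensity`, `meanEnergy_hopping_add_mul_le_of_le_diagHop`). [cite: BratteliRobinsonII1997, §6.2.4] [cite: KomaTasaki1994, §1] -/
theorem hoppingFloor_of_negKinetic_le_of_le_diagHop {κ : ℝ} (hκ : 0 ≤ κ) {X B : ℝ}
    (hX : ∀ (ω : InfVolFermionState 2) (Ls : ℕ → ℕ) (ψ : ∀ L, Fock (Orb (FermionTorus 2 L))),
      Tendsto Ls atTop atTop →
      (∀ j, IsGroundStateInSector (hubbardTorusTT' (Ls j) 1 0 U₀) (rectN n (Ls j)) 0 (ψ (Ls j))) →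
      (∀ j, star (ψ (Ls j)) ⬝ᵥ ψ (Ls j) = 1) → ω.IsTorusLimitOf ψ Ls →
      -(∑ i : Fin 2, -(1 : ℝ) * ∑ σ : Fin 2,
          ((ω.expect {0, 0 + unitVec i}
              ((cAt 0 (mem_insert_self _ _) σ)ᴴ * cAt (0 + unitVec i) (mem_insert_of_mem (mem_singleton_self _)) σ)).re +
            (ω.expect {0, 0 + unitVec i}
              ((cAt (0 + unitVec i) (mem_insert_of_mem (mem_singleton_self _)) σ)ᴴ * cAt 0 (mem_insert_self _ _) σ)).re)) ≤ X)
    (hB : ∀ (ω : InfVolFermionState 2) (Ls : ℕ → ℕ) (ψ : ∀ L, Fock (Orb (FermionTorus 2 L))),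
      Tendsto Ls atTop atTop →
      (∀ j, IsGroundStateInSector (hubbardTorusTT' (Ls j) 1 0 U₀) (rectN n (Ls j)) 0 (ψ (Ls j))) →
      (∀ j, star (ψ (Ls j)) ⬝ᵥ ψ (Ls j) = 1) → ω.IsTorusLimitOf ψ Ls →
      B ≤ ω.meanEnergy (hubbardTTPrimeFermionInteraction 0 1 0) 1) :
    ∀ (ω : InfVolFermionState 2) (Ls : ℕ → ℕ) (ψ : ∀ L, Fock (Orb (FermionTorus 2 L))),
      Tendsto Ls atTop atTop →
      (∀ j, IsGroundStateInSector (hubbardTorusTT' (Ls j) 1 0 U₀) (rectN n (Ls j)) 0 (ψ (Ls j))) →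
      (∀ j, star (ψ (Ls j)) ⬝ᵥ ψ (Ls j) = 1) → ω.IsTorusLimitOf ψ Ls →
      -X + κ * B ≤ ω.meanEnergy (hubbardTTPrimeFermionInteraction 1 κ 0) 1 := by
  intro ω Ls ψ hLs hψ h1 hω
  have hk := hX ω Ls ψ hLs hψ h1 hω
  rw [← meanEnergy_hubbardTTPrime_oneBody_eq_kineticDensity hω.isTranslationInvariant] at hk
  have hcmp := InfVolFermionState.meanEnergy_hopping_add_mul_le_of_le_diagHop ω 1 (κ := 0) (κ' := κ) hκ (hB ω Ls ψ hLs hψ h1 hω)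
  rw [sub_zero] at hcmp
  linarith

end Adapter

/-! ## §2 Corollaries: the `t′ = 0` station as the RIGHT member of the weighted bracket -/

section Corollaries

variable {t'P UP n s₁ U₁ U₀ : ℝ}

/-- **«own-word-and-floor × ray station».** Left = the class `(s₁, U₁, n)`'s OWN f-sum orbit-lower family `v₁` plus a floor `B₁ ≤ K₂`, orientation `2s₁ ≤ κ₁`; right = a
`t′ = 0` station `(0, U₀)`, `0 ≤ U₀ < U_P`, with kinetic ceiling `−k ≤ X` and `K₂` floor `B₀`, apex hopping `κ₂ = −U₀t′_P/(U_P − U₀) ≥ 0`. Then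
`ObsStiffnessSeqCeilingAt t′_P U_P n c` for every `c ≥ μ₁(−v₁ − (κ₁ − 2s₁)B₁/4) + μ₂(X − κ₂B₀)/4`. [cite: KomaTasaki1994, §1] [cite: ScalapinoWhiteZhang1993, §II] -/
theorem ObsStiffnessSeqCeilingAt_of_two_apexSources_weighted_of_fsumFloor_negKinetic (Uo₁ : ℝ) (hU₁0 : 0 ≤ U₁) (hU₁ : U₁ < UP)
    (hU₀0 : 0 ≤ U₀) (hU₀ : U₀ < UP) (hn0 : 0 ≤ n) (hn2 : n < 2) {μ₁ μ₂ : ℝ} (hμ₁ : 0 ≤ μ₁) (hμ₂ : 0 ≤ μ₂) (hμ : μ₁ + μ₂ = 1)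
    (hκ : μ₁ * ((UP * s₁ - U₁ * t'P) / (UP - U₁)) + μ₂ * ((UP * 0 - U₀ * t'P) / (UP - U₀)) = 2 * t'P)
    (h2s₁ : 2 * s₁ ≤ (UP * s₁ - U₁ * t'P) / (UP - U₁)) (hκ₂ : 0 ≤ (UP * 0 - U₀ * t'P) / (UP - U₀)) {v₁ : ℝ}
    (h₁ : ∀ (ω : InfVolFermionState 2) (Ls : ℕ → ℕ) (ψ : ∀ L, Fock (Orb (FermionTorus 2 L))),
      Tendsto Ls atTop atTop →
      (∀ j, IsGroundStateInSector (hubbardTorusTT' (Ls j) 1 s₁ U₁) (rectN n (Ls j)) 0 (ψ (Ls j))) →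
      (∀ j, star (ψ (Ls j)) ⬝ᵥ ψ (Ls j) = 1) → ω.IsTorusLimitOf ψ Ls →
      v₁ ≤ ((Finset.univ : Finset (DihedralGroup 4)).card : ℝ)⁻¹ * ∑ g ∈ (Finset.univ : Finset (DihedralGroup 4)),
        (ω.expect (d4ShiftSet g 0 (box 2 7)) (fermionEmbed (PolySite.d4Emb g 0 (box 2 7)) (-oddMomentObsTT s₁ Uo₁ 0))).re)
    {B₁ : ℝ}
    (hB₁ : ∀ (ω : InfVolFermionState 2) (Ls : ℕ → ℕ) (ψ : ∀ L, Fock (Orb (FermionTorus 2 L))),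
      Tendsto Ls atTop atTop →
      (∀ j, IsGroundStateInSector (hubbardTorusTT' (Ls j) 1 s₁ U₁) (rectN n (Ls j)) 0 (ψ (Ls j))) →
      (∀ j, star (ψ (Ls j)) ⬝ᵥ ψ (Ls j) = 1) → ω.IsTorusLimitOf ψ Ls →
      B₁ ≤ ω.meanEnergy (hubbardTTPrimeFermionInteraction 0 1 0) 1)
    {X B₀ : ℝ}
    (hX : ∀ (ω : InfVolFermionState 2) (Ls : ℕ → ℕ) (ψ : ∀ L, Fock (Orb (FermionTorus 2 L))),
      Tendsto Ls atTop atTop →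
      (∀ j, IsGroundStateInSector (hubbardTorusTT' (Ls j) 1 0 U₀) (rectN n (Ls j)) 0 (ψ (Ls j))) →
      (∀ j, star (ψ (Ls j)) ⬝ᵥ ψ (Ls j) = 1) → ω.IsTorusLimitOf ψ Ls →
      -(∑ i : Fin 2, -(1 : ℝ) * ∑ σ : Fin 2,
          ((ω.expect {0, 0 + unitVec i}
              ((cAt 0 (mem_insert_self _ _) σ)ᴴ * cAt (0 + unitVec i) (mem_insert_of_mem (mem_singleton_self _)) σ)).re +
            (ω.expect {0, 0 + unitVec i}
              ((cAt (0 + unitVec i) (mem_insert_of_mem (mem_singleton_self _)) σ)ᴴ * cAt 0 (mem_insert_self _ _) σ)).re)) ≤ X)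
    (hB₀ : ∀ (ω : InfVolFermionState 2) (Ls : ℕ → ℕ) (ψ : ∀ L, Fock (Orb (FermionTorus 2 L))),
      Tendsto Ls atTop atTop →
      (∀ j, IsGroundStateInSector (hubbardTorusTT' (Ls j) 1 0 U₀) (rectN n (Ls j)) 0 (ψ (Ls j))) →
      (∀ j, star (ψ (Ls j)) ⬝ᵥ ψ (Ls j) = 1) → ω.IsTorusLimitOf ψ Ls →
      B₀ ≤ ω.meanEnergy (hubbardTTPrimeFermionInteraction 0 1 0) 1)
    (c : ℚ) (hc : μ₁ * (-v₁ - ((UP * s₁ - U₁ * t'P) / (UP - U₁) - 2 * s₁) * B₁ / 4) +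
      μ₂ * ((X - ((UP * 0 - U₀ * t'P) / (UP - U₀)) * B₀) / 4) ≤ ((c : ℚ) : ℝ)) :
    ObsStiffnessSeqCeilingAt t'P UP n c :=
  ObsStiffnessSeqCeilingAt_of_two_apexSources_weighted hU₁0 hU₁ hU₀0 hU₀ hn0 hn2 hμ₁ hμ₂ hμ hκ
    (hoppingFloor_of_ownSlot_orbitLower_of_le_diagHop Uo₁ v₁ h2s₁ h₁ hB₁)
    (hoppingFloor_of_negKinetic_le_of_le_diagHop hκ₂ hX hB₀) c (by
      have e : -(μ₁ * (4 * v₁ + ((UP * s₁ - U₁ * t'P) / (UP - U₁) - 2 * s₁) * B₁) +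
            μ₂ * (-X + (UP * 0 - U₀ * t'P) / (UP - U₀) * B₀)) / 4 =
          μ₁ * (-v₁ - ((UP * s₁ - U₁ * t'P) / (UP - U₁) - 2 * s₁) * B₁ / 4) +
            μ₂ * ((X - ((UP * 0 - U₀ * t'P) / (UP - U₀)) * B₀) / 4) := by ring
      rw [e]; exact hc)

/-- **«own-word-and-ceiling × ray station».** As above with the left member used BEYOND its slot: orientation `κ₁ ≤ 2s₁` and a CEILING `K₂ ≤ A₁` on the class
`(s₁, U₁, n)`; `c ≥ μ₁(−v₁ − (κ₁ − 2s₁)A₁/4) + μ₂(X − κ₂B₀)/4`. [cite: KomaTasaki1994, §1] [cite: ScalapinoWhiteZhang1993, §II] -/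
theorem ObsStiffnessSeqCeilingAt_of_two_apexSources_weighted_of_fsumCeil_negKinetic (Uo₁ : ℝ) (hU₁0 : 0 ≤ U₁) (hU₁ : U₁ < UP)
    (hU₀0 : 0 ≤ U₀) (hU₀ : U₀ < UP) (hn0 : 0 ≤ n) (hn2 : n < 2) {μ₁ μ₂ : ℝ} (hμ₁ : 0 ≤ μ₁) (hμ₂ : 0 ≤ μ₂) (hμ : μ₁ + μ₂ = 1)
    (hκ : μ₁ * ((UP * s₁ - U₁ * t'P) / (UP - U₁)) + μ₂ * ((UP * 0 - U₀ * t'P) / (UP - U₀)) = 2 * t'P)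
    (h2s₁ : (UP * s₁ - U₁ * t'P) / (UP - U₁) ≤ 2 * s₁) (hκ₂ : 0 ≤ (UP * 0 - U₀ * t'P) / (UP - U₀)) {v₁ : ℝ}
    (h₁ : ∀ (ω : InfVolFermionState 2) (Ls : ℕ → ℕ) (ψ : ∀ L, Fock (Orb (FermionTorus 2 L))),
      Tendsto Ls atTop atTop →
      (∀ j, IsGroundStateInSector (hubbardTorusTT' (Ls j) 1 s₁ U₁) (rectN n (Ls j)) 0 (ψ (Ls j))) →
      (∀ j, star (ψ (Ls j)) ⬝ᵥ ψ (Ls j) = 1) → ω.IsTorusLimitOf ψ Ls →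
      v₁ ≤ ((Finset.univ : Finset (DihedralGroup 4)).card : ℝ)⁻¹ * ∑ g ∈ (Finset.univ : Finset (DihedralGroup 4)),
        (ω.expect (d4ShiftSet g 0 (box 2 7)) (fermionEmbed (PolySite.d4Emb g 0 (box 2 7)) (-oddMomentObsTT s₁ Uo₁ 0))).re)
    {A₁ : ℝ}
    (hA₁ : ∀ (ω : InfVolFermionState 2) (Ls : ℕ → ℕ) (ψ : ∀ L, Fock (Orb (FermionTorus 2 L))),
      Tendsto Ls atTop atTop →
      (∀ j, IsGroundStateInSector (hubbardTorusTT' (Ls j) 1 s₁ U₁) (rectN n (Ls j)) 0 (ψ (Ls j))) →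
      (∀ j, star (ψ (Ls j)) ⬝ᵥ ψ (Ls j) = 1) → ω.IsTorusLimitOf ψ Ls →
      ω.meanEnergy (hubbardTTPrimeFermionInteraction 0 1 0) 1 ≤ A₁)
    {X B₀ : ℝ}
    (hX : ∀ (ω : InfVolFermionState 2) (Ls : ℕ → ℕ) (ψ : ∀ L, Fock (Orb (FermionTorus 2 L))),
      Tendsto Ls atTop atTop →
      (∀ j, IsGroundStateInSector (hubbardTorusTT' (Ls j) 1 0 U₀) (rectN n (Ls j)) 0 (ψ (Ls j))) →
      (∀ j, star (ψ (Ls j)) ⬝ᵥ ψ (Ls j) = 1) → ω.IsTorusLimitOf ψ Ls →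
      -(∑ i : Fin 2, -(1 : ℝ) * ∑ σ : Fin 2,
          ((ω.expect {0, 0 + unitVec i}
              ((cAt 0 (mem_insert_self _ _) σ)ᴴ * cAt (0 + unitVec i) (mem_insert_of_mem (mem_singleton_self _)) σ)).re +
            (ω.expect {0, 0 + unitVec i}
              ((cAt (0 + unitVec i) (mem_insert_of_mem (mem_singleton_self _)) σ)ᴴ * cAt 0 (mem_insert_self _ _) σ)).re)) ≤ X)
    (hB₀ : ∀ (ω : InfVolFermionState 2) (Ls : ℕ → ℕ) (ψ : ∀ L, Fock (Orb (FermionTorus 2 L))),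
      Tendsto Ls atTop atTop →
      (∀ j, IsGroundStateInSector (hubbardTorusTT' (Ls j) 1 0 U₀) (rectN n (Ls j)) 0 (ψ (Ls j))) →
      (∀ j, star (ψ (Ls j)) ⬝ᵥ ψ (Ls j) = 1) → ω.IsTorusLimitOf ψ Ls →
      B₀ ≤ ω.meanEnergy (hubbardTTPrimeFermionInteraction 0 1 0) 1)
    (c : ℚ) (hc : μ₁ * (-v₁ - ((UP * s₁ - U₁ * t'P) / (UP - U₁) - 2 * s₁) * A₁ / 4) +
      μ₂ * ((X - ((UP * 0 - U₀ * t'P) / (UP - U₀)) * B₀) / 4) ≤ ((c : ℚ) : ℝ)) :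
    ObsStiffnessSeqCeilingAt t'P UP n c :=
  ObsStiffnessSeqCeilingAt_of_two_apexSources_weighted hU₁0 hU₁ hU₀0 hU₀ hn0 hn2 hμ₁ hμ₂ hμ hκ
    (hoppingFloor_of_ownSlot_orbitLower_of_diagHop_le Uo₁ v₁ h2s₁ h₁ hA₁)
    (hoppingFloor_of_negKinetic_le_of_le_diagHop hκ₂ hX hB₀) c (by
      have e : -(μ₁ * (4 * v₁ + ((UP * s₁ - U₁ * t'P) / (UP - U₁) - 2 * s₁) * A₁) +
            μ₂ * (-X + (UP * 0 - U₀ * t'P) / (UP - U₀) * B₀)) / 4 =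
          μ₁ * (-v₁ - ((UP * s₁ - U₁ * t'P) / (UP - U₁) - 2 * s₁) * A₁ / 4) +
            μ₂ * ((X - ((UP * 0 - U₀ * t'P) / (UP - U₀)) * B₀) / 4) := by ring
      rw [e]; exact hc)

/-- **«slot × ray station».** Left = an orbit-lower family for an END objective at the slot `2σ₁ = κ₁` on the class `(s₁, U₁, n)` (lever zero; e.g. the σ-chord of two end objectives);
right = the `t′ = 0` station as above. `c ≥ μ₁(−v₁) + μ₂(X − κ₂B₀)/4`. [cite: KomaTasaki1994, §1] [cite: ScalapinoWhiteZhang1993, §II] -/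
theorem ObsStiffnessSeqCeilingAt_of_two_apexSources_weighted_of_slot_negKinetic (Uo₁ : ℝ) (hU₁0 : 0 ≤ U₁) (hU₁ : U₁ < UP)
    (hU₀0 : 0 ≤ U₀) (hU₀ : U₀ < UP) (hn0 : 0 ≤ n) (hn2 : n < 2) {μ₁ μ₂ : ℝ} (hμ₁ : 0 ≤ μ₁) (hμ₂ : 0 ≤ μ₂) (hμ : μ₁ + μ₂ = 1)
    (hκ : μ₁ * ((UP * s₁ - U₁ * t'P) / (UP - U₁)) + μ₂ * ((UP * 0 - U₀ * t'P) / (UP - U₀)) = 2 * t'P) {σ₁ : ℝ}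
    (hσ₁ : 2 * σ₁ = (UP * s₁ - U₁ * t'P) / (UP - U₁)) (hκ₂ : 0 ≤ (UP * 0 - U₀ * t'P) / (UP - U₀)) {v₁ : ℝ}
    (h₁ : ∀ (ω : InfVolFermionState 2) (Ls : ℕ → ℕ) (ψ : ∀ L, Fock (Orb (FermionTorus 2 L))),
      Tendsto Ls atTop atTop →
      (∀ j, IsGroundStateInSector (hubbardTorusTT' (Ls j) 1 s₁ U₁) (rectN n (Ls j)) 0 (ψ (Ls j))) →
      (∀ j, star (ψ (Ls j)) ⬝ᵥ ψ (Ls j) = 1) → ω.IsTorusLimitOf ψ Ls →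
      v₁ ≤ ((Finset.univ : Finset (DihedralGroup 4)).card : ℝ)⁻¹ * ∑ g ∈ (Finset.univ : Finset (DihedralGroup 4)),
        (ω.expect (d4ShiftSet g 0 (box 2 7)) (fermionEmbed (PolySite.d4Emb g 0 (box 2 7)) (-oddMomentObsTT σ₁ Uo₁ 0))).re)
    {X B₀ : ℝ}
    (hX : ∀ (ω : InfVolFermionState 2) (Ls : ℕ → ℕ) (ψ : ∀ L, Fock (Orb (FermionTorus 2 L))),
      Tendsto Ls atTop atTop →
      (∀ j, IsGroundStateInSector (hubbardTorusTT' (Ls j) 1 0 U₀) (rectN n (Ls j)) 0 (ψ (Ls j))) →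
      (∀ j, star (ψ (Ls j)) ⬝ᵥ ψ (Ls j) = 1) → ω.IsTorusLimitOf ψ Ls →
      -(∑ i : Fin 2, -(1 : ℝ) * ∑ σ : Fin 2,
          ((ω.expect {0, 0 + unitVec i}
              ((cAt 0 (mem_insert_self _ _) σ)ᴴ * cAt (0 + unitVec i) (mem_insert_of_mem (mem_singleton_self _)) σ)).re +
            (ω.expect {0, 0 + unitVec i}
              ((cAt (0 + unitVec i) (mem_insert_of_mem (mem_singleton_self _)) σ)ᴴ * cAt 0 (mem_insert_self _ _) σ)).re)) ≤ X)
    (hB₀ : ∀ (ω : InfVolFermionState 2) (Ls : ℕ → ℕ) (ψ : ∀ L, Fock (Orb (FermionTorus 2 L))),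
      Tendsto Ls atTop atTop →
      (∀ j, IsGroundStateInSector (hubbardTorusTT' (Ls j) 1 0 U₀) (rectN n (Ls j)) 0 (ψ (Ls j))) →
      (∀ j, star (ψ (Ls j)) ⬝ᵥ ψ (Ls j) = 1) → ω.IsTorusLimitOf ψ Ls →
      B₀ ≤ ω.meanEnergy (hubbardTTPrimeFermionInteraction 0 1 0) 1)
    (c : ℚ) (hc : μ₁ * (-v₁) + μ₂ * ((X - ((UP * 0 - U₀ * t'P) / (UP - U₀)) * B₀) / 4) ≤ ((c : ℚ) : ℝ)) :
    ObsStiffnessSeqCeilingAt t'P UP n c :=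
  ObsStiffnessSeqCeilingAt_of_two_apexSources_weighted hU₁0 hU₁ hU₀0 hU₀ hn0 hn2 hμ₁ hμ₂ hμ hκ
    (hoppingFloor_of_slot_orbitLower Uo₁ v₁ hσ₁ h₁)
    (hoppingFloor_of_negKinetic_le_of_le_diagHop hκ₂ hX hB₀) c (by
      have e : -(μ₁ * (4 * v₁) + μ₂ * (-X + (UP * 0 - U₀ * t'P) / (UP - U₀) * B₀)) / 4 =
          μ₁ * (-v₁) + μ₂ * ((X - ((UP * 0 - U₀ * t'P) / (UP - U₀)) * B₀) / 4) := by ring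
      rw [e]; exact hc)

/-- **«ray station × Fermi-sea row».** Source 1 = the `t′ = 0` station `(0, U₀)`, `0 ≤ U₀ < U_P`, kinetic ceiling `−k ≤ X`, `K₂` floor `B₀`, apex hopping
`κ₁ = −U₀t′_P/(U_P − U₀) ≥ 0`; member 2 = a free-gas floor `ℓ₂ ≤ e(1, κ₂, 0, n)` at a hopping `κ₂` on the OTHER side of `2t′_P` (for `t′_P < 0`: `κ₂ ≤ 2t′_P`, weights
`anchor_weights_left`). `c ≥ μ₁(X − κ₁B₀)/4 + μ₂(−ℓ₂/4)`. [cite: KomaTasaki1994, §1] [cite: LiebLoss1993, §8, Theorem 8.2] -/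
theorem ObsStiffnessSeqCeilingAt_of_rayStation_fermiSeaRow_weighted (hU₀0 : 0 ≤ U₀) (hU₀ : U₀ < UP) (hn0 : 0 ≤ n) (hn2 : n < 2)
    {μ₁ μ₂ : ℝ} (hμ₁ : 0 ≤ μ₁) (hμ₂ : 0 ≤ μ₂) (hμ : μ₁ + μ₂ = 1) (κ₂ : ℝ)
    (hκ : μ₁ * ((UP * 0 - U₀ * t'P) / (UP - U₀)) + μ₂ * κ₂ = 2 * t'P) (hκ₁ : 0 ≤ (UP * 0 - U₀ * t'P) / (UP - U₀)) {X B₀ ℓ₂ : ℝ}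
    (hX : ∀ (ω : InfVolFermionState 2) (Ls : ℕ → ℕ) (ψ : ∀ L, Fock (Orb (FermionTorus 2 L))),
      Tendsto Ls atTop atTop →
      (∀ j, IsGroundStateInSector (hubbardTorusTT' (Ls j) 1 0 U₀) (rectN n (Ls j)) 0 (ψ (Ls j))) →
      (∀ j, star (ψ (Ls j)) ⬝ᵥ ψ (Ls j) = 1) → ω.IsTorusLimitOf ψ Ls →
      -(∑ i : Fin 2, -(1 : ℝ) * ∑ σ : Fin 2,
          ((ω.expect {0, 0 + unitVec i}
              ((cAt 0 (mem_insert_self _ _) σ)ᴴ * cAt (0 + unitVec i) (mem_insert_of_mem (mem_singleton_self _)) σ)).re +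
            (ω.expect {0, 0 + unitVec i}
              ((cAt (0 + unitVec i) (mem_insert_of_mem (mem_singleton_self _)) σ)ᴴ * cAt 0 (mem_insert_self _ _) σ)).re)) ≤ X)
    (hB₀ : ∀ (ω : InfVolFermionState 2) (Ls : ℕ → ℕ) (ψ : ∀ L, Fock (Orb (FermionTorus 2 L))),
      Tendsto Ls atTop atTop →
      (∀ j, IsGroundStateInSector (hubbardTorusTT' (Ls j) 1 0 U₀) (rectN n (Ls j)) 0 (ψ (Ls j))) →
      (∀ j, star (ψ (Ls j)) ⬝ᵥ ψ (Ls j) = 1) → ω.IsTorusLimitOf ψ Ls →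
      B₀ ≤ ω.meanEnergy (hubbardTTPrimeFermionInteraction 0 1 0) 1)
    (h₂ : ℓ₂ ≤ energyDensityTT' 1 κ₂ 0 n)
    (c : ℚ) (hc : μ₁ * ((X - ((UP * 0 - U₀ * t'P) / (UP - U₀)) * B₀) / 4) + μ₂ * (-ℓ₂ / 4) ≤ ((c : ℚ) : ℝ)) :
    ObsStiffnessSeqCeilingAt t'P UP n c :=
  ObsStiffnessSeqCeilingAt_of_apexSource_fermiSeaRow_weighted hU₀0 hU₀ hn0 hn2 hμ₁ hμ₂ hμ κ₂ hκ
    (hoppingFloor_of_negKinetic_le_of_le_diagHop hκ₁ hX hB₀) h₂ c (by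
      have e : -(μ₁ * (-X + (UP * 0 - U₀ * t'P) / (UP - U₀) * B₀) + μ₂ * ℓ₂) / 4 =
          μ₁ * ((X - ((UP * 0 - U₀ * t'P) / (UP - U₀)) * B₀) / 4) + μ₂ * (-ℓ₂ / 4) := by ring
      rw [e]; exact hc)

end Corollaries

/-! ## §3 (append, same seat, same session) The `t′ = 0` station for targets with `t′ > 0`: apex hopping `κ ≤ 0`, `K₂` CEILING -/

section NegativeHopping

variable {t'P UP n U₀ : ℝ}

/-- **Kinetic ceiling + `K₂` CEILING ⇒ hopping floor at `κ ≤ 0` (`t′ = 0` station, target with `t′ > 0`).** If `−k(ω) ≤ X` and `K₂(ω) ≤ A` on the torus-limit ground-state class of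
`(0, U₀, n)`, then `−X + κA ≤ e_{Φ(1,κ,0)}(ω)` on that class for every `κ ≤ 0` (`meanEnergy_hopping_le_add_mul_of_diagHop_le` from `κ` up to `0`; with the kinematic `A = 1.6211390` the
price is `|κ|·1.6211390`, the mirror image of §1). [cite: BratteliRobinsonII1997, §6.2.4] [cite: KomaTasaki1994, §1] -/
theorem hoppingFloor_of_negKinetic_le_of_diagHop_le {κ : ℝ} (hκ : κ ≤ 0) {X A : ℝ}
    (hX : ∀ (ω : InfVolFermionState 2) (Ls : ℕ → ℕ) (ψ : ∀ L, Fock (Orb (FermionTorus 2 L))),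
      Tendsto Ls atTop atTop →
      (∀ j, IsGroundStateInSector (hubbardTorusTT' (Ls j) 1 0 U₀) (rectN n (Ls j)) 0 (ψ (Ls j))) →
      (∀ j, star (ψ (Ls j)) ⬝ᵥ ψ (Ls j) = 1) → ω.IsTorusLimitOf ψ Ls →
      -(∑ i : Fin 2, -(1 : ℝ) * ∑ σ : Fin 2,
          ((ω.expect {0, 0 + unitVec i}
              ((cAt 0 (mem_insert_self _ _) σ)ᴴ * cAt (0 + unitVec i) (mem_insert_of_mem (mem_singleton_self _)) σ)).re +
            (ω.expect {0, 0 + unitVec i}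
              ((cAt (0 + unitVec i) (mem_insert_of_mem (mem_singleton_self _)) σ)ᴴ * cAt 0 (mem_insert_self _ _) σ)).re)) ≤ X)
    (hA : ∀ (ω : InfVolFermionState 2) (Ls : ℕ → ℕ) (ψ : ∀ L, Fock (Orb (FermionTorus 2 L))),
      Tendsto Ls atTop atTop →
      (∀ j, IsGroundStateInSector (hubbardTorusTT' (Ls j) 1 0 U₀) (rectN n (Ls j)) 0 (ψ (Ls j))) →
      (∀ j, star (ψ (Ls j)) ⬝ᵥ ψ (Ls j) = 1) → ω.IsTorusLimitOf ψ Ls →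
      ω.meanEnergy (hubbardTTPrimeFermionInteraction 0 1 0) 1 ≤ A) :
    ∀ (ω : InfVolFermionState 2) (Ls : ℕ → ℕ) (ψ : ∀ L, Fock (Orb (FermionTorus 2 L))),
      Tendsto Ls atTop atTop →
      (∀ j, IsGroundStateInSector (hubbardTorusTT' (Ls j) 1 0 U₀) (rectN n (Ls j)) 0 (ψ (Ls j))) →
      (∀ j, star (ψ (Ls j)) ⬝ᵥ ψ (Ls j) = 1) → ω.IsTorusLimitOf ψ Ls →
      -X + κ * A ≤ ω.meanEnergy (hubbardTTPrimeFermionInteraction 1 κ 0) 1 := by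
  intro ω Ls ψ hLs hψ h1 hω
  have hk := hX ω Ls ψ hLs hψ h1 hω
  rw [← meanEnergy_hubbardTTPrime_oneBody_eq_kineticDensity hω.isTranslationInvariant] at hk
  have hcmp := InfVolFermionState.meanEnergy_hopping_le_add_mul_of_diagHop_le ω 1 (κ := κ) (κ' := 0) hκ (hA ω Ls ψ hLs hψ h1 hω)
  rw [zero_sub] at hcmp
  linarith

/-- **«ray station × Fermi-sea row», target with `t′ > 0`.** Source 1 = the `t′ = 0` station `(0, U₀)`, `0 ≤ U₀ < U_P`, kinetic ceiling `−k ≤ X`, `K₂` CEILING `A₀`, apex hopping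
`κ₁ = −U₀t′_P/(U_P − U₀) ≤ 0`; member 2 = a free-gas floor `ℓ₂ ≤ e(1, κ₂, 0, n)` at a hopping `κ₂ ≥ 2t′_P` (weights `bracket_weights`). `c ≥ μ₁(X − κ₁A₀)/4 + μ₂(−ℓ₂/4)`.
[cite: KomaTasaki1994, §1] [cite: LiebLoss1993, §8, Theorem 8.2] -/
theorem ObsStiffnessSeqCeilingAt_of_rayStation_fermiSeaRow_weighted_of_diagHop_le (hU₀0 : 0 ≤ U₀) (hU₀ : U₀ < UP) (hn0 : 0 ≤ n) (hn2 : n < 2)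
    {μ₁ μ₂ : ℝ} (hμ₁ : 0 ≤ μ₁) (hμ₂ : 0 ≤ μ₂) (hμ : μ₁ + μ₂ = 1) (κ₂ : ℝ)
    (hκ : μ₁ * ((UP * 0 - U₀ * t'P) / (UP - U₀)) + μ₂ * κ₂ = 2 * t'P) (hκ₁ : (UP * 0 - U₀ * t'P) / (UP - U₀) ≤ 0) {X A₀ ℓ₂ : ℝ}
    (hX : ∀ (ω : InfVolFermionState 2) (Ls : ℕ → ℕ) (ψ : ∀ L, Fock (Orb (FermionTorus 2 L))),
      Tendsto Ls atTop atTop →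
      (∀ j, IsGroundStateInSector (hubbardTorusTT' (Ls j) 1 0 U₀) (rectN n (Ls j)) 0 (ψ (Ls j))) →
      (∀ j, star (ψ (Ls j)) ⬝ᵥ ψ (Ls j) = 1) → ω.IsTorusLimitOf ψ Ls →
      -(∑ i : Fin 2, -(1 : ℝ) * ∑ σ : Fin 2,
          ((ω.expect {0, 0 + unitVec i}
              ((cAt 0 (mem_insert_self _ _) σ)ᴴ * cAt (0 + unitVec i) (mem_insert_of_mem (mem_singleton_self _)) σ)).re +
            (ω.expect {0, 0 + unitVec i}
              ((cAt (0 + unitVec i) (mem_insert_of_mem (mem_singleton_self _)) σ)ᴴ * cAt 0 (mem_insert_self _ _) σ)).re)) ≤ X)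
    (hA₀ : ∀ (ω : InfVolFermionState 2) (Ls : ℕ → ℕ) (ψ : ∀ L, Fock (Orb (FermionTorus 2 L))),
      Tendsto Ls atTop atTop →
      (∀ j, IsGroundStateInSector (hubbardTorusTT' (Ls j) 1 0 U₀) (rectN n (Ls j)) 0 (ψ (Ls j))) →
      (∀ j, star (ψ (Ls j)) ⬝ᵥ ψ (Ls j) = 1) → ω.IsTorusLimitOf ψ Ls →
      ω.meanEnergy (hubbardTTPrimeFermionInteraction 0 1 0) 1 ≤ A₀)
    (h₂ : ℓ₂ ≤ energyDensityTT' 1 κ₂ 0 n)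
    (c : ℚ) (hc : μ₁ * ((X - ((UP * 0 - U₀ * t'P) / (UP - U₀)) * A₀) / 4) + μ₂ * (-ℓ₂ / 4) ≤ ((c : ℚ) : ℝ)) :
    ObsStiffnessSeqCeilingAt t'P UP n c :=
  ObsStiffnessSeqCeilingAt_of_apexSource_fermiSeaRow_weighted hU₀0 hU₀ hn0 hn2 hμ₁ hμ₂ hμ κ₂ hκ
    (hoppingFloor_of_negKinetic_le_of_diagHop_le hκ₁ hX hA₀) h₂ c (by
      have e : -(μ₁ * (-X + (UP * 0 - U₀ * t'P) / (UP - U₀) * A₀) + μ₂ * ℓ₂) / 4 =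
          μ₁ * ((X - ((UP * 0 - U₀ * t'P) / (UP - U₀)) * A₀) / 4) + μ₂ * (-ℓ₂ / 4) := by ring
      rw [e]; exact hc)

end NegativeHopping

end Summit.Ventures.CertifiedManyBodySolver.Observables

end
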